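import Summits.NavierStokesRegularity.NavierStokesRegularity.Theorems.TypeICertificateLadderTargetStrainCubeSharpDepletion
import Summits.NavierStokesRegularity.NavierStokesRegularity.Theorems.TypeICertificateLadderTargetStretchingNumber
import Summits.NavierStokesRegularity.NavierStokesRegularity.Theorems.TypeICertificateLadderTargetDepletionLambPairing
import Summits.NavierStokesRegularity.NavierStokesRegularity.Theorems.TypeICertificateLadderTargetLambHelicitySlack
import Literature.Analysis.FluidPDE.LocalBiotSavartCalculus
import Literature.Analysis.FluidPDE.LeiZhang2011Proofs
import HarnessLib

/-!
# Crux `Target` = `TypeICertificateLadder.NoTypeIBlowup` (stmt-NavierStokesRegularity-1217), line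
# `depletion-ladder`: THE LAMB / STRAIN-CUBE SPLIT — the two representations of the stretching integral
# charge ORTHOGONAL components of the velocity

`--supports stmt-NavierStokesRegularity-1217` (helper; first of three files: pointwise step here, fixed-weight integral in
`…StrainCubeLambSplit`, limit + constant + rungs in `…StrainCubeLambSplitDepletion`). Author: STA lineage `ns-sta-19551-p1` (g11).

The landed depletion chain (`…StrainCube*`, constant `κ = (2+√3)/9 ≈ 0.4147`, reach `C < 18 − 9√3 ≈ 2.41`)
bounds `J = ∫⟪ω, Dv ω⟫` through `J = −4∫det S`, Miller's `|4 det S| ≤ (2√6/9)|S|³`, and the weighted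
integration by parts `∫|S|²N = ½∫N⟪v, curl ω⟫ − ∫ v·S∇N` (`Δv = −curl ω`); the landed Lamb pairing
(`…DepletionLambPairing`) writes the same number as `J = ∫⟪v, ω × curl ω⟫`. The first chain term pairs `v`
with `curl ω`, the Lamb integrand pairs `v` with `ω × curl ω ⊥ curl ω`: the two representations charge
ORTHOGONAL components of `v(x)`, and `|v(x)| ≤ M` bounds the two components JOINTLY
(`abs_lamb_add_abs_axial_le`: `α|⟪v, ω × c⟫| + β|⟪v, c⟫| ≤ ‖v‖‖c‖√(α²‖ω‖² + β²)`). Writing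
`|J| = (1−λ)|J| + λ|J|` and bounding the first copy by the Lamb form, the second by the chain, the joint
bound gives, for every admissible weight `N` (`0 ≤ N ≤ |S|`, the regularisations of `|S|` of the landed files)
and every `λ ∈ [0,1]` (`lamb_split_weight_le`, next file; here its integrand form `lamb_split_pointwise`):

  `(1−λ)|J| + λ(2√6/9)∫|S|²N ≤ M( ‖curl ω‖₂ √((1−λ)²‖ω‖₂² + (λ√6/9)²∫|S|²) + λ(2√6/9)√(2/3) ‖S‖₂ ‖∇S‖₂ )`.

The third file `…StrainCubeLambSplitDepletion` lets `N ↑ |S|`, inserts `‖S‖₂² = ½‖ω‖₂²`, `‖∇S‖₂² = ½‖∇ω‖₂²`,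
`‖curl ω‖₂ = ‖∇ω‖₂` and optimises `λ`: the universal depletion constant drops from `(2+√3)/9` to
`(9 + 2√15)/42 ≈ 0.3987` and the constant-form reach rises from `18 − 9√3 ≈ 2.4115` to `18 − 4√15 ≈ 2.508`
— an input beating `κ = (2+√3)/9` (director-ns 2026-08-27T15:18Z (ii): «non-pointwise depletion»), i.e. the
landed chain is NOT rigid. WHAT THIS IS NOT: not the crux; a 4 % lift of a perturbative constant. [folklore]

References: Constantin, Comm. Math. Phys. 129 (1990) (Lamb variables); E. Miller, ARMA 235 (2020) Prop. 4.8;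
Majda–Bertozzi 2002, Prop. 2.16 (`curl curl = −Δ` on divergence-free fields).
-/

noncomputable section

open Set Function Filter Topology MeasureTheory Finset
open scoped RealInnerProductSpace ENNReal NNReal Laplacian ContDiff
open Literature.Analysis.FluidPDE

namespace Summit.NavierStokesRegularity.NavierStokesRegularity.Theorems.DepletionLadder.StrainCube

-- the problem directory repeats the summit name (`NavierStokesRegularity/NavierStokesRegularity`)
set_option linter.dupNamespace false

open Summit.NavierStokesRegularity.NavierStokesRegularity.Theorems.RungReynoldsOne
open Summit.NavierStokesRegularity.NavierStokesRegularity.Theorems.RungReynoldsOne.WeightedSlice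
open Summit.NavierStokesRegularity.NavierStokesRegularity.Theorems.DepletionLadder

/-! ## Pointwise algebra in `ℝ³`: the joint bound on two orthogonal pairings -/

/-- Cyclicity of the triple product: `⟪c, v × w⟫ = ⟪v, w × c⟫`. [folklore] -/
theorem inner_cross_cyclic (v w c : EuclideanSpace ℝ (Fin 3)) : ⟪c, cross v w⟫ = ⟪v, cross w c⟫ := by
  rw [inner_cross_eq, inner_cross_eq]; ring

/-- A sign with `s·x = |x|` and `s² = 1`. [folklore] -/
theorem exists_sign_mul_eq_abs (x : ℝ) : ∃ s : ℝ, s * x = |x| ∧ s ^ 2 = 1 := by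
  by_cases h : 0 ≤ x
  · exact ⟨1, by rw [abs_of_nonneg h]; ring, by ring⟩
  · exact ⟨-1, by rw [abs_of_neg (not_le.1 h)]; ring, by ring⟩

/-- **The joint bound on the two orthogonal pairings.** For `v, w, c ∈ ℝ³` and real `α, β`:
`α |⟪v, w × c⟫| + β |⟪v, c⟫| ≤ ‖v‖ · ‖c‖ · √(α² ‖w‖² + β²)`.
Proof: `⟪v, w × c⟫ = ⟪c, v × w⟫`, so the left side is `⟪c, z⟫` with `z = ±α (v × w) ± β v`; since
`v × w ⊥ v`, `‖z‖² = α²‖v × w‖² + β²‖v‖² ≤ ‖v‖²(α²‖w‖² + β²)`. (In the application `c = curl w`: the Lamb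
integrand sees the component of `v` orthogonal to `curl w`, the strain-cube term the component along it.)
[folklore] -/
theorem abs_lamb_add_abs_axial_le (v w c : EuclideanSpace ℝ (Fin 3)) (α β : ℝ) :
    α * |⟪v, cross w c⟫| + β * |⟪v, c⟫| ≤ ‖v‖ * ‖c‖ * Real.sqrt (α ^ 2 * ‖w‖ ^ 2 + β ^ 2) := by
  obtain ⟨sQ, hsQ, hsQ2⟩ := exists_sign_mul_eq_abs ⟪v, cross w c⟫
  obtain ⟨sP, hsP, hsP2⟩ := exists_sign_mul_eq_abs ⟪v, c⟫
  set z : EuclideanSpace ℝ (Fin 3) := (α * sQ) • cross v w + (β * sP) • v with hz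
  have hcz : ⟪c, z⟫ = α * |⟪v, cross w c⟫| + β * |⟪v, c⟫| := by
    rw [hz, inner_add_right, inner_smul_right, inner_smul_right, inner_cross_cyclic, real_inner_comm v c,
      ← hsQ, ← hsP]
    ring
  have horth : ⟪cross v w, v⟫ = 0 := inner_cross_curl_left v w
  have hz2 : ‖z‖ ^ 2 = α ^ 2 * ‖cross v w‖ ^ 2 + β ^ 2 * ‖v‖ ^ 2 := by
    rw [hz, norm_add_sq_real, norm_smul, norm_smul, inner_smul_left, inner_smul_right, horth,
      Real.norm_eq_abs, Real.norm_eq_abs, mul_pow, mul_pow, sq_abs, sq_abs, mul_pow, mul_pow, hsQ2, hsP2]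
    simp
  have hcr := norm_cross_le_norm_mul_norm v w
  have hz2le : ‖z‖ ^ 2 ≤ (‖v‖ * Real.sqrt (α ^ 2 * ‖w‖ ^ 2 + β ^ 2)) ^ 2 := by
    rw [hz2, mul_pow, Real.sq_sqrt (by positivity)]
    have h1 : ‖cross v w‖ ^ 2 ≤ (‖v‖ * ‖w‖) ^ 2 := pow_le_pow_left₀ (norm_nonneg _) hcr 2
    nlinarith [sq_nonneg α, sq_nonneg β]
  have hzle : ‖z‖ ≤ ‖v‖ * Real.sqrt (α ^ 2 * ‖w‖ ^ 2 + β ^ 2) := by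
    rw [← Real.sqrt_sq (norm_nonneg z),
      ← Real.sqrt_sq (by positivity : 0 ≤ ‖v‖ * Real.sqrt (α ^ 2 * ‖w‖ ^ 2 + β ^ 2))]
    exact Real.sqrt_le_sqrt hz2le
  calc α * |⟪v, cross w c⟫| + β * |⟪v, c⟫| = ⟪c, z⟫ := hcz.symm
    _ ≤ ‖c‖ * ‖z‖ := real_inner_le_norm _ _
    _ ≤ ‖c‖ * (‖v‖ * Real.sqrt (α ^ 2 * ‖w‖ ^ 2 + β ^ 2)) := mul_le_mul_of_nonneg_left hzle (norm_nonneg _)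
    _ = ‖v‖ * ‖c‖ * Real.sqrt (α ^ 2 * ‖w‖ ^ 2 + β ^ 2) := by ring

variable {v : EuclideanSpace ℝ (Fin 3) → EuclideanSpace ℝ (Fin 3)}
  {s : Fin 3 → Fin 3 → EuclideanSpace ℝ (Fin 3) → ℝ} {N : EuclideanSpace ℝ (Fin 3) → ℝ}

/-! ## The pointwise step of the split chain -/

/-- `⟪v, curl (curl v)⟫ = −Σᵢ vᵢ (Δv)ᵢ` for a smooth divergence-free field (`curl curl v = −Δv`). [folklore] -/
theorem inner_curl_curl_eq_neg_sum (hv : ContDiff ℝ ∞ v) (hdiv : VectorCalculus.IsDivFree v)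
    (x : EuclideanSpace ℝ (Fin 3)) :
    ⟪v x, curl (curl v) x⟫ = -(∑ i, v x i * (Δ v) x i) := by
  rw [curl_curl_eq_neg_laplacian (hv.of_le (by norm_cast)) hdiv x, inner_neg_right]
  simp [PiLp.inner_apply, Fin.sum_univ_three, mul_comm]

/-- **The pointwise split bound.** With `|v| ≤ M`, `0 ≤ N`, `Σⱼ(∂ⱼN)² ≤ D`, `0 ≤ λ`, `ω = curl v`,
`c = curl ω`:
`(1−λ)|⟪v, ω × c⟫| + λ(2√6/9)·(−Σᵢⱼ ∂ⱼ(sᵢⱼN) vᵢ) ≤ M(‖c‖ √((1−λ)²‖ω‖² + (λ√6 N/9)²) + λ(2√6/9)√(2/3) √q √D)`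
(the chain's first term is `(λ√6/9) N ⟪v, c⟫`, the joint bound `abs_lamb_add_abs_axial_le` takes it together
with the Lamb integrand; the `S∇N` term keeps its operator-norm bound). [folklore] -/
theorem lamb_split_pointwise (hv : ContDiff ℝ ∞ v) (hdiv : VectorCalculus.IsDivFree v)
    (hs : ∀ i j y, s i j y = (pderiv j (fun z => v z i) y + pderiv i (fun z => v z j) y) / 2)
    (hN : Differentiable ℝ N) {M D lam : ℝ} (hlam0 : 0 ≤ lam)
    (x : EuclideanSpace ℝ (Fin 3)) (hM : ‖v x‖ ≤ M) (hN0 : 0 ≤ N x) (hD : ∑ j, pderiv j N x ^ 2 ≤ D) :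
    (1 - lam) * |⟪v x, cross (curl v x) (curl (curl v) x)⟫| +
        lam * ((2 / 9) * Real.sqrt 6) * -(∑ i, ∑ j, pderiv j (fun y => s i j y * N y) x * v x i) ≤
      M * (‖curl (curl v) x‖ *
          Real.sqrt ((1 - lam) ^ 2 * ‖curl v x‖ ^ 2 + (lam * (Real.sqrt 6 / 9) * N x) ^ 2) +
        lam * ((2 / 9) * Real.sqrt 6) *
          (Real.sqrt (2 / 3) * (Real.sqrt (∑ i, ∑ j, s i j x ^ 2) * Real.sqrt D))) := by
  rw [sum_pderiv_mul_weight_eq hv hdiv hs hN x]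
  obtain ⟨hsym, htr⟩ := sym_symm_trace hv hdiv hs x
  have hM0 : 0 ≤ M := (norm_nonneg _).trans hM
  have h6 : 0 ≤ Real.sqrt 6 := Real.sqrt_nonneg _
  have h23 : 0 ≤ Real.sqrt (2 / 3) := Real.sqrt_nonneg _
  -- the chain's first term is `(λ√6/9)·N·⟪v, c⟫`
  have hhalf : ∑ i, v x i * ((1 / 2) * (Δ v) x i) = (1 / 2) * ∑ i, v x i * (Δ v) x i := by
    rw [Finset.mul_sum]; exact Finset.sum_congr rfl fun i _ => by ring
  have hP : ∑ i, v x i * (Δ v) x i = -⟪v x, curl (curl v) x⟫ := by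
    rw [inner_curl_curl_eq_neg_sum hv hdiv x, neg_neg]
  -- joint bound on the Lamb term and the first chain term
  have hβ : 0 ≤ lam * (Real.sqrt 6 / 9) * N x := by positivity
  have hjoint := abs_lamb_add_abs_axial_le (v x) (curl v x) (curl (curl v) x) (1 - lam)
    (lam * (Real.sqrt 6 / 9) * N x)
  have a1 : (1 - lam) * |⟪v x, cross (curl v x) (curl (curl v) x)⟫| +
      lam * ((2 / 9) * Real.sqrt 6) * -(N x * ∑ i, v x i * ((1 / 2) * (Δ v) x i)) ≤
      M * (‖curl (curl v) x‖ *
        Real.sqrt ((1 - lam) ^ 2 * ‖curl v x‖ ^ 2 + (lam * (Real.sqrt 6 / 9) * N x) ^ 2)) := by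
    have e : lam * ((2 / 9) * Real.sqrt 6) * -(N x * ∑ i, v x i * ((1 / 2) * (Δ v) x i)) =
        lam * (Real.sqrt 6 / 9) * N x * ⟪v x, curl (curl v) x⟫ := by
      rw [hhalf, hP]; ring
    rw [e]
    have h2 : lam * (Real.sqrt 6 / 9) * N x * ⟪v x, curl (curl v) x⟫ ≤
        lam * (Real.sqrt 6 / 9) * N x * |⟪v x, curl (curl v) x⟫| :=
      mul_le_mul_of_nonneg_left (le_abs_self _) hβ
    have h3 : ‖v x‖ * ‖curl (curl v) x‖ *
        Real.sqrt ((1 - lam) ^ 2 * ‖curl v x‖ ^ 2 + (lam * (Real.sqrt 6 / 9) * N x) ^ 2) ≤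
        M * ‖curl (curl v) x‖ *
        Real.sqrt ((1 - lam) ^ 2 * ‖curl v x‖ ^ 2 + (lam * (Real.sqrt 6 / 9) * N x) ^ 2) :=
      mul_le_mul_of_nonneg_right (mul_le_mul_of_nonneg_right hM (norm_nonneg _)) (Real.sqrt_nonneg _)
    linarith [hjoint, h2, h3]
  -- the `S∇N` term, with the operator-norm gain
  have t2 := abs_bilin_sym_le (fun i j => s i j x) hsym htr (fun i => v x i) (fun j => pderiv j N x)
  have ev : Real.sqrt (∑ i, v x i ^ 2) = ‖v x‖ := by
    rw [← norm_sq_eq_sum_sq, Real.sqrt_sq (norm_nonneg _)]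
  rw [ev] at t2
  have hD0 : 0 ≤ D := (sum_nonneg fun _ _ => sq_nonneg _).trans hD
  have hsD : Real.sqrt (∑ j, pderiv j N x ^ 2) ≤ Real.sqrt D := Real.sqrt_le_sqrt hD
  have hq0 : 0 ≤ Real.sqrt (∑ i, ∑ j, s i j x ^ 2) := Real.sqrt_nonneg _
  have a2 : lam * ((2 / 9) * Real.sqrt 6) * -(∑ i, v x i * ∑ j, s i j x * pderiv j N x) ≤
      M * (lam * ((2 / 9) * Real.sqrt 6) *
        (Real.sqrt (2 / 3) * (Real.sqrt (∑ i, ∑ j, s i j x ^ 2) * Real.sqrt D))) := by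
    have h := neg_abs_le (∑ i, v x i * ∑ j, s i j x * pderiv j N x)
    have h2 : Real.sqrt (2 / 3) * Real.sqrt (∑ i, ∑ j, s i j x ^ 2) * ‖v x‖ *
        Real.sqrt (∑ j, pderiv j N x ^ 2) ≤
        Real.sqrt (2 / 3) * Real.sqrt (∑ i, ∑ j, s i j x ^ 2) * M * Real.sqrt D :=
      mul_le_mul (mul_le_mul_of_nonneg_left hM (by positivity)) hsD (Real.sqrt_nonneg _) (by positivity)
    have hc : 0 ≤ lam * ((2 / 9) * Real.sqrt 6) := by positivity
    have h4 : -(∑ i, v x i * ∑ j, s i j x * pderiv j N x) ≤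
        M * (Real.sqrt (2 / 3) * (Real.sqrt (∑ i, ∑ j, s i j x ^ 2) * Real.sqrt D)) := by
      linarith [t2]
    calc lam * ((2 / 9) * Real.sqrt 6) * -(∑ i, v x i * ∑ j, s i j x * pderiv j N x)
        ≤ lam * ((2 / 9) * Real.sqrt 6) *
          (M * (Real.sqrt (2 / 3) * (Real.sqrt (∑ i, ∑ j, s i j x ^ 2) * Real.sqrt D))) :=
          mul_le_mul_of_nonneg_left h4 hc
      _ = _ := by ring
  rw [neg_add, mul_add, mul_add]
  linarith [a1, a2]

end Summit.NavierStokesRegularity.NavierStokesRegularity.Theorems.DepletionLadder.StrainCube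

end
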